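import Summits.AtomisticToContinuum.Crystallization.Theses.ThreeConeCertificate
import Summits.AtomisticToContinuum.Crystallization.Theorems.ChargedEnergyGap.Negative.Unconditional
import Summits.AtomisticToContinuum.Crystallization.Theorems.OnePercentCertificate.Negative.ValueLowerBound

/-!
# `KeplerBound` (stmt-AtomisticToContinuum-11961): the item is exactly conjunct (i) of the summit

Support file for the item `ThreeConeCertificate.KeplerBound` of route `ThreeConeCertificate`
(shared with `BraggSlacknessRigidity`; gen-1 twin stmt-3102):

`∃ P periodic, ∀ N, ∀ x : Fin N → ℝ³ injective, N · e_LJ(P) ≤ E_LJ(x)`.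

Nothing here closes the item.  We certify what it says.  With `e* = ⨅_Q e_LJ(Q)` the infimum of
the Lennard-Jones energy per particle over periodic configurations of `ℝ³`
(`ChargedEnergyGapNegative.eStar`; a genuine infimum, `bddBelow_energyPerParticle_lennardJones`):

* `keplerBound_iff_exists_le_eStar`, `keplerBound_iff_exists_eq_eStar` — `KeplerBound` iff some
  periodic configuration has `e(P) ≤ e*`, equivalently `e(P) = e*`: by periodisation
  `N · e* ≤ E_LJ(x)` for every finite injective `x` (`card_mul_eStar_le`), and large blocks of
  near-optimal periodic configurations are trial states with `E_LJ < N (e* + δ)`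
  (`exists_trialState`);
* `keplerBound_iff_exists_isLeast` — iff the periodic infimum is ATTAINED (a periodic minimiser
  of the Lennard-Jones energy per particle exists);
* `keplerBound_iff_exists_tendsto` — iff `E(N)/N` converges to the energy per particle of some
  periodic configuration (`E(N)/N → e*` holds unconditionally, `crysEnergyLimit`);
* `keplerBound_iff_hasPeriodicGroundStateEnergy` — **`KeplerBound ↔ HasPeriodicGroundStateEnergy
  lennardJones 3`**, conjunct (i) of the sub-problem `Crystallization`, whence
  `crystallization_iff_keplerBound_and_isCrystallizing`;
* `keplerBound_iff_forall_pos` — the reformulation `∃ P, ∀ N ≥ 1, e(P) ≤ E(N)/N`;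
* `keplerBound_of_exactCertificate` — inside the route the item follows from the crux
  `ExactCertificate` (item 11959) by the three-cone mechanism (`CertificateBound`, item 11962;
  `onePercentCertificate_value_lower_bound`).

So the support item is open exactly as conjunct (i) is open — the attained periodic minimum of
the Lennard-Jones energy per particle in `ℝ³` (Blanc–Lewin 2015, §2.3: "completely open in
dimension three"); no finite-`N` content separates it from the asymptotic statement.  (The same
equivalences were first checked in the crux work file `Cruxes/ExactCertificate/Disproof.lean` §2,
which is not importable from `Theorems`; the proofs below are independent and rest only on landed
`Theorems` files.)
-/

noncomputable section

namespace Summit.AtomisticToContinuum.Crystallization.Theorems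

open Literature.MathematicalPhysics.StatisticalMechanics
open Summit.AtomisticToContinuum.Crystallization.Theses.ThreeConeCertificate
  (KeplerBound ExactCertificate)
open Summit.AtomisticToContinuum.Crystallization.Theorems.ChargedEnergyGapNegative
  (eStar card_mul_eStar_le exists_trialState eStar_le crysEnergyLimit
    eStar_le_groundStateEnergy_div)
open Filter Topology

/-- **`KeplerBound` forces `e(P) ≤ e*`**: test the finite-`N` bound on the block trial states
`E_LJ(y) < N (e* + δ)` of `exists_trialState`. [folklore] -/
theorem exists_le_eStar_of_keplerBound (h : KeplerBound) :
    ∃ P : PeriodicConfiguration 3, P.energyPerParticle lennardJones ≤ eStar := by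
  obtain ⟨P, hP⟩ := h
  refine ⟨P, le_of_forall_pos_lt_add fun δ hδ => ?_⟩
  obtain ⟨N, y, hN, hy, hE⟩ := exists_trialState hδ
  have hNr : (0 : ℝ) < N := by exact_mod_cast hN
  have hlt : (N : ℝ) * P.energyPerParticle lennardJones < N * (eStar + δ) := (hP N y hy).trans_lt hE
  exact lt_of_mul_lt_mul_left hlt hNr.le

/-- **A periodic configuration with `e(P) ≤ e*` witnesses `KeplerBound`**: `N · e(P) ≤ N · e* ≤
E_LJ(x)` by periodisation (`card_mul_eStar_le`). [folklore] -/
theorem keplerBound_of_le_eStar {P : PeriodicConfiguration 3}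
    (hP : P.energyPerParticle lennardJones ≤ eStar) : KeplerBound :=
  ⟨P, fun N _ hx => (mul_le_mul_of_nonneg_left hP (Nat.cast_nonneg N)).trans (card_mul_eStar_le hx)⟩

/-- **`KeplerBound ↔ ∃ P, e(P) ≤ e*`.** [folklore] -/
theorem keplerBound_iff_exists_le_eStar :
    KeplerBound ↔ ∃ P : PeriodicConfiguration 3, P.energyPerParticle lennardJones ≤ eStar :=
  ⟨exists_le_eStar_of_keplerBound, fun ⟨_, hP⟩ => keplerBound_of_le_eStar hP⟩

/-- **`KeplerBound ↔ ∃ P, e(P) = e*`** (`e* ≤ e(Q)` for every periodic `Q`, `eStar_le`). [folklore] -/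
theorem keplerBound_iff_exists_eq_eStar :
    KeplerBound ↔ ∃ P : PeriodicConfiguration 3, P.energyPerParticle lennardJones = eStar := by
  rw [keplerBound_iff_exists_le_eStar]
  exact exists_congr fun P => ⟨fun h => le_antisymm h (eStar_le P), fun h => h.le⟩

/-- **`KeplerBound ↔` the periodic infimum of the Lennard-Jones energy per particle is attained**
(a periodic minimiser exists). [folklore] -/
theorem keplerBound_iff_exists_isLeast :
    KeplerBound ↔ ∃ P : PeriodicConfiguration 3,
      IsLeast (Set.range fun Q : PeriodicConfiguration 3 => Q.energyPerParticle lennardJones)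
        (P.energyPerParticle lennardJones) := by
  rw [keplerBound_iff_exists_le_eStar]
  refine exists_congr fun P => ⟨fun h => ⟨⟨P, rfl⟩, ?_⟩, fun h => le_ciInf fun Q => h.2 ⟨Q, rfl⟩⟩
  rintro _ ⟨Q, rfl⟩
  exact h.trans (eStar_le Q)

/-- **`KeplerBound ↔ E(N)/N` converges to a periodic energy per particle** (`E(N)/N → e*`
unconditionally, `crysEnergyLimit`, and limits are unique). [folklore] -/
theorem keplerBound_iff_exists_tendsto :
    KeplerBound ↔ ∃ P : PeriodicConfiguration 3,
      Tendsto (fun N : ℕ => groundStateEnergy lennardJones 3 N / N) atTop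
        (𝓝 (P.energyPerParticle lennardJones)) := by
  rw [keplerBound_iff_exists_eq_eStar]
  refine exists_congr fun P => ⟨fun h => ?_, fun h => tendsto_nhds_unique h crysEnergyLimit⟩
  rw [h]
  exact crysEnergyLimit

/-- **`KeplerBound ↔ HasPeriodicGroundStateEnergy lennardJones 3`**: the support item is EXACTLY
conjunct (i) of the sub-problem `Crystallization` (the energetic form of the crystallization
conjecture for Lennard-Jones in `ℝ³`, Blanc–Lewin 2015 §1.3 (8), §2.3). [folklore] -/
theorem keplerBound_iff_hasPeriodicGroundStateEnergy :
    KeplerBound ↔ HasPeriodicGroundStateEnergy lennardJones 3 := by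
  constructor
  · intro h
    obtain ⟨P, hle⟩ := exists_le_eStar_of_keplerBound h
    have heq : P.energyPerParticle lennardJones = eStar := le_antisymm hle (eStar_le P)
    refine ⟨P, ⟨⟨P, rfl⟩, ?_⟩, ?_⟩
    · rintro _ ⟨Q, rfl⟩
      exact hle.trans (eStar_le Q)
    · rw [heq]
      exact crysEnergyLimit
  · rintro ⟨P, hP, -⟩
    exact keplerBound_iff_exists_isLeast.2 ⟨P, hP⟩

/-- Hence **`Crystallization ↔ KeplerBound ∧ IsCrystallizing lennardJones 3`**: the item is one
half of the sub-problem. [folklore] -/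
theorem crystallization_iff_keplerBound_and_isCrystallizing :
    _root_.Crystallization ↔ KeplerBound ∧ IsCrystallizing lennardJones 3 := by
  rw [keplerBound_iff_hasPeriodicGroundStateEnergy]
  rfl

/-- **`KeplerBound ↔ ∃ P, ∀ N ≥ 1, e(P) ≤ E(N)/N`** (the quantifier over configurations folded
into the ground-state energy; `e* ≤ E(N)/N`, `eStar_le_groundStateEnergy_div`). [folklore] -/
theorem keplerBound_iff_forall_pos :
    KeplerBound ↔ ∃ P : PeriodicConfiguration 3, ∀ N : ℕ, 0 < N →
      P.energyPerParticle lennardJones ≤ groundStateEnergy lennardJones 3 N / N := by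
  rw [keplerBound_iff_exists_le_eStar]
  refine exists_congr fun P => ⟨fun h N hN => h.trans (eStar_le_groundStateEnergy_div hN), fun h => ?_⟩
  refine le_of_forall_pos_lt_add fun δ hδ => ?_
  obtain ⟨N, y, hN, hy, hE⟩ := exists_trialState hδ
  have hNr : (0 : ℝ) < N := by exact_mod_cast hN
  have h1 : P.energyPerParticle lennardJones ≤ interactionEnergy lennardJones y / N :=
    (h N hN).trans (div_le_div_of_nonneg_right (groundStateEnergy_lennardJones_le hy) hNr.le)
  have h2 : interactionEnergy lennardJones y / N < eStar + δ := by
    rw [div_lt_iff₀ hNr, mul_comm]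
    exact hE
  exact h1.trans_lt h2

/-- **Inside the route: `ExactCertificate → KeplerBound`** (the three-cone mechanism of item
11962 `CertificateBound`: `V_LJ = g + U + f` termwise on distinct points, `U`-cone `≥ 0`, Bochner
form with unit weights, `g`-stability, `c + f(0)/2 = −e(P)`; `onePercentCertificate_value_lower_bound`).
[cite: Ruelle1969, §3.2 Prop. 3.2.7] -/
theorem keplerBound_of_exactCertificate (h : ExactCertificate) : KeplerBound := by
  obtain ⟨P, ρ, c, g, U, f, hdec, hU, -, hpos, hstab, hval⟩ := h
  refine ⟨P, fun N x hx => ?_⟩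
  have h1 := onePercentCertificate_value_lower_bound hdec hU hpos hstab hx
  rw [hval] at h1
  linarith

end Summit.AtomisticToContinuum.Crystallization.Theorems

end
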